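import Mathlib
import Literature.Analysis.FluidPDE.BiotSavartFarField
import Literature.Analysis.FluidPDE.BiotSavartDivCurl
import Literature.Analysis.FluidPDE.WholeSpaceIBPIntegrable
import Literature.Analysis.FluidPDE.RapidDecayLemmas
import Literature.Analysis.FluidPDE.LeiZhang2011Proofs
import HarnessLib

/-!
# The pressure pairing of a rapidly decaying divergence-free field vanishes
  (tools for item stmt-NavierStokesRegularity-1445, `QuasipotentialCoercivity.EnstrophyToL3Coercivity`)

On `ℝ³ = EuclideanSpace ℝ (Fin 3)`: if `w ∈ C¹` is divergence free and decays with its derivative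
like `(1 + ‖x‖)^{-5}`, and `q ∈ C²` has `∇q = f − h` with `f ∈ L² ∩ C⁰` and `h` continuous,
`‖h‖ ≲ (1 + ‖x‖)^{-4}`, and `⟪w, ∇q⟫ ∈ L¹`, then `∫ ⟪w, ∇q⟫ = 0` — **no growth condition on `q`**.
Mechanism (the three-dimensional version of the planar device of
`QuasipotentialCoercivityTwoDimensionalActionBoundCancel`): `w = curl ψ` with `ψ = biotSavart w`
(tree: `curl_biotSavart_holds`, `contDiff_biotSavart_of_contDiff`, far field
`exists_forall_one_add_norm_pow_three_mul_norm_biotSavart_le_of_isDivFree`: `‖ψ‖ ≲ (1 + ‖x‖)^{-3}`),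
and `⟪∇q, curl ψ⟫ = div (ψ × ∇q) + ⟪ψ, curl ∇q⟫ = div (ψ × ∇q)` (`divergence_cross_holds`,
`curl_gradient_eq_zero_holds`); the field `ψ × ∇q` is `C¹` and integrable (`‖ψ‖ ‖f‖ ≤ ½(‖ψ‖² + ‖f‖²)`,
`‖ψ‖ ‖h‖ ≲ (1 + ‖x‖)^{-7}`), so the whole-space divergence theorem in `L¹` form
(`integral_divergence_eq_zero_of_integrable`) gives `∫ div (ψ × ∇q) = 0`.

This is what lets the energy identity of a forced classical path be used with an UNCONTROLLED
pressure: the Navier–Stokes equation controls only `g − ∇q`, and `∇q ∈ L² + 𝒮` at every time at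
which `g ∈ L²`.

HONEST FRAMING: elementary vector calculus about forced classical paths; nothing here bears on
Navier–Stokes regularity.

## References
* A. J. Majda, A. L. Bertozzi, *Vorticity and Incompressible Flow*, CUP (2002), §1.7 Lemma 1.5,
  §2.4.1 Prop. 2.16.
* P. G. Lemarié-Rieusset, *The Navier–Stokes Problem in the 21st Century*, CRC (2016), §4.10 (4.37).
-/

noncomputable section

set_option linter.dupNamespace false

namespace Summit.NavierStokesRegularity.NavierStokesRegularity.Theorems

open Set MeasureTheory Filter Topology Function InnerProductSpace
open scoped ENNReal NNReal RealInnerProductSpace ContDiff Laplacian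
open Literature.Analysis.FluidPDE

namespace EnstrophyToL3

/-- Integrability on `ℝ³` from a decay bound `‖g x‖ ≤ C (1 + ‖x‖)^{-r}`, `r > 3`. [folklore] -/
theorem integrable_of_le_decay₃ {G : Type*} [NormedAddCommGroup G] {g : EuclideanSpace ℝ (Fin 3) → G}
    (hg : Continuous g) {C r : ℝ} (hr : 3 < r) (h : ∀ x, ‖g x‖ ≤ C * (1 + ‖x‖) ^ (-r)) :
    Integrable g volume := by
  refine integrable_of_norm_le_rpow_neg (μ := volume) hg ?_ h
  simpa [finrank_euclideanSpace_fin] using hr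

/-- **The Biot–Savart potential of a rapidly decaying divergence-free field**: for `w ∈ C¹(ℝ³; ℝ³)`,
`div w = 0`, `‖w‖, ‖Dw‖ ≤ C (1 + ‖x‖)^{-5}`, the field `ψ = biotSavart w` is `C¹`, satisfies
`curl ψ = w`, and `‖ψ x‖ ≤ K' (1 + ‖x‖)^{-3}` for some `K' ≥ 0` (tree: Majda–Bertozzi Prop. 2.16,
Lemarié-Rieusset (4.37)). [folklore] -/
theorem biotSavart_potential₃ {w : EuclideanSpace ℝ (Fin 3) → EuclideanSpace ℝ (Fin 3)}
    (hw : ContDiff ℝ 1 w) (hdiv : VectorCalculus.IsDivFree w) {C : ℝ} (hC : 0 ≤ C)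
    (h0 : ∀ x, ‖w x‖ ≤ C * (1 + ‖x‖) ^ (-(5 : ℝ)))
    (h1 : ∀ x, ‖fderiv ℝ w x‖ ≤ C * (1 + ‖x‖) ^ (-(5 : ℝ))) :
    ContDiff ℝ 1 (biotSavart w) ∧ curl (biotSavart w) = w ∧
      ∃ K' : ℝ, 0 ≤ K' ∧ ∀ x, ‖biotSavart w x‖ ≤ K' * (1 + ‖x‖) ^ (-(3 : ℝ)) := by
  have hle1 : ∀ x : EuclideanSpace ℝ (Fin 3), (1 + ‖x‖) ^ (-(5 : ℝ)) ≤ (1 : ℝ) := fun x =>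
    rpow_neg_le_one x (by norm_num)
  have hwC : ∀ x, ‖w x‖ ≤ C := fun x => (h0 x).trans (by
    simpa using mul_le_mul_of_nonneg_left (hle1 x) hC)
  have hDwC : ∀ x, ‖fderiv ℝ w x‖ ≤ C := fun x => (h1 x).trans (by
    simpa using mul_le_mul_of_nonneg_left (hle1 x) hC)
  have hwi : Integrable w volume := integrable_of_le_decay₃ hw.continuous (by norm_num) h0
  have hDwi : Integrable (fun x => fderiv ℝ w x) volume :=
    integrable_of_le_decay₃ (hw.continuous_fderiv one_ne_zero) (by norm_num) h1
  have hψ1 : ContDiff ℝ 1 (biotSavart w) := contDiff_biotSavart_of_contDiff hw hwi hwC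
  have hcurl : curl (biotSavart w) = w :=
    curl_biotSavart_holds w hw hdiv hwi hDwi ⟨C, fun x => ⟨hwC x, hDwC x⟩⟩
  -- moments of `w`
  have hM1 : Integrable (fun y : EuclideanSpace ℝ (Fin 3) => ‖y‖ * ‖w y‖) volume := by
    refine integrable_of_le_decay₃ (C := C) (r := 4) (continuous_norm.mul hw.continuous.norm)
      (by norm_num) fun y => ?_
    rw [norm_mul, norm_norm, norm_norm]
    have hy : ‖y‖ ≤ (1 + ‖y‖) := by linarith [norm_nonneg y]
    have hpos : (0 : ℝ) < 1 + ‖y‖ := by positivity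
    calc ‖y‖ * ‖w y‖ ≤ (1 + ‖y‖) * (C * (1 + ‖y‖) ^ (-(5 : ℝ))) :=
          mul_le_mul hy (h0 y) (norm_nonneg _) hpos.le
      _ = C * ((1 + ‖y‖) ^ (1 : ℝ) * (1 + ‖y‖) ^ (-(5 : ℝ))) := by rw [Real.rpow_one]; ring
      _ = C * (1 + ‖y‖) ^ (-(4 : ℝ)) := by
          rw [← Real.rpow_add hpos]; norm_num
  have hM4 : ∀ y : EuclideanSpace ℝ (Fin 3), ‖y‖ ^ 4 * ‖w y‖ ≤ C := by
    intro y
    have hpos : (0 : ℝ) < 1 + ‖y‖ := by positivity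
    have hy4 : ‖y‖ ^ 4 ≤ (1 + ‖y‖) ^ (4 : ℝ) := by
      rw [show ((4 : ℝ)) = ((4 : ℕ) : ℝ) by norm_num, Real.rpow_natCast]
      exact pow_le_pow_left₀ (norm_nonneg _) (by linarith [norm_nonneg y]) 4
    calc ‖y‖ ^ 4 * ‖w y‖ ≤ (1 + ‖y‖) ^ (4 : ℝ) * (C * (1 + ‖y‖) ^ (-(5 : ℝ))) :=
          mul_le_mul hy4 (h0 y) (norm_nonneg _) (by positivity)
      _ = C * ((1 + ‖y‖) ^ (4 : ℝ) * (1 + ‖y‖) ^ (-(5 : ℝ))) := by ring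
      _ = C * (1 + ‖y‖) ^ (-(1 : ℝ)) := by rw [← Real.rpow_add hpos]; norm_num
      _ ≤ C * 1 := by
          refine mul_le_mul_of_nonneg_left (rpow_neg_le_one y (by norm_num)) hC
      _ = C := mul_one C
  obtain ⟨K, hK, hfar⟩ := exists_forall_one_add_norm_pow_three_mul_norm_biotSavart_le_of_isDivFree
  set K' : ℝ := K * (C + (∫ y, ‖w y‖) + (∫ y, ‖y‖ * ‖w y‖) + C) with hK'
  have hK'0 : 0 ≤ K' := by
    have h1' : 0 ≤ ∫ y, ‖w y‖ := integral_nonneg fun _ => norm_nonneg _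
    have h2' : 0 ≤ ∫ y, ‖y‖ * ‖w y‖ := integral_nonneg fun _ => by positivity
    positivity
  refine ⟨hψ1, hcurl, K', hK'0, fun x => ?_⟩
  have h := hfar hw hdiv hwi hM1 hwC hM4 x
  have hpos : (0 : ℝ) < 1 + ‖x‖ := by positivity
  have hp3 : (0 : ℝ) < (1 + ‖x‖) ^ (3 : ℕ) := by positivity
  rw [show (-(3 : ℝ)) = -((3 : ℕ) : ℝ) by norm_num, Real.rpow_neg hpos.le, Real.rpow_natCast,
    ← div_eq_mul_inv, le_div_iff₀ hp3, mul_comm]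
  exact h

/-- **The pressure pairing vanishes** (`ℝ³`): `w ∈ C¹` divergence free with `‖w‖, ‖Dw‖ ≲ (1+‖x‖)^{-5}`,
`q ∈ C²` with `∇q = f − h`, `f` continuous with `∫⁻ ‖f‖ₑ² < ∞`, `h` continuous with
`‖h‖ ≲ (1 + ‖x‖)^{-4}`, and `⟪w, ∇q⟫ ∈ L¹` ⇒ `∫ ⟪w, ∇q⟫ = 0` (Majda–Bertozzi Lemma 1.5 without any
growth hypothesis on `q`: `⟪∇q, w⟫ = div(ψ × ∇q)`, `ψ = biotSavart w`, and the `L¹` divergence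
theorem). [folklore] -/
theorem integral_inner_gradient_eq_zero₃ {w f h : EuclideanSpace ℝ (Fin 3) → EuclideanSpace ℝ (Fin 3)}
    {q : EuclideanSpace ℝ (Fin 3) → ℝ}
    (hw : ContDiff ℝ 1 w) (hdiv : VectorCalculus.IsDivFree w) {C : ℝ} (hC : 0 ≤ C)
    (h0 : ∀ x, ‖w x‖ ≤ C * (1 + ‖x‖) ^ (-(5 : ℝ)))
    (h1 : ∀ x, ‖fderiv ℝ w x‖ ≤ C * (1 + ‖x‖) ^ (-(5 : ℝ)))
    (hq : ContDiff ℝ 2 q) (hsplit : ∀ x, gradient q x = f x - h x) (cf : Continuous f)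
    (hf : ∫⁻ x, ‖f x‖ₑ ^ 2 < ⊤) (ch : Continuous h) {Ch : ℝ}
    (hh : ∀ x, ‖h x‖ ≤ Ch * (1 + ‖x‖) ^ (-(4 : ℝ)))
    (hI : Integrable (fun x => ⟪w x, gradient q x⟫) volume) :
    ∫ x, ⟪w x, gradient q x⟫ = 0 := by
  obtain ⟨hψ1, hcurl, K', hK'0, hψ⟩ := biotSavart_potential₃ hw hdiv hC h0 h1
  set ψ := biotSavart w with hψdef
  have cψ : Continuous ψ := hψ1.continuous
  have hgq1 : ContDiff ℝ 1 (gradient q) := by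
    have : gradient q = fun x => (InnerProductSpace.toDual ℝ (EuclideanSpace ℝ (Fin 3))).symm
        (fderiv ℝ q x) := rfl
    rw [this]
    exact (InnerProductSpace.toDual ℝ (EuclideanSpace ℝ (Fin 3))).symm.contDiff.comp
      (hq.fderiv_right (m := 1) (by norm_num))
  have cgq : Continuous (gradient q) := hgq1.continuous
  -- the field `Z = ψ × ∇q`
  set Z : EuclideanSpace ℝ (Fin 3) → EuclideanSpace ℝ (Fin 3) :=
    fun x => cross (ψ x) (gradient q x) with hZdef
  have hZ1 : ContDiff ℝ 1 Z := by
    have : Z = fun x => crossCLM (ψ x) (gradient q x) := by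
      funext x; simp [hZdef, crossCLM_apply]
    rw [this]
    exact (crossCLM.contDiff.comp hψ1).clm_apply hgq1
  -- its divergence is `⟪w, ∇q⟫`
  have hdivZ : ∀ x, VectorCalculus.divergence Z x = ⟪w x, gradient q x⟫ := by
    intro x
    have hd := divergence_cross_holds ψ (gradient q) x
      ((hψ1.differentiable one_ne_zero) x) ((hgq1.differentiable one_ne_zero) x)
    rw [hZdef]
    rw [hd, hcurl, curl_gradient_eq_zero_holds q hq x, inner_zero_right, sub_zero, real_inner_comm]
  -- `Z ∈ L¹`
  have hf2 : Integrable (fun x => ‖f x‖ ^ 2) volume := by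
    refine ⟨(cf.norm.pow 2).aestronglyMeasurable, ?_⟩
    refine (hasFiniteIntegral_iff_enorm).2 (lt_of_le_of_lt (le_of_eq ?_) hf)
    refine lintegral_congr fun x => ?_
    rw [Real.enorm_eq_ofReal (sq_nonneg _), ← ofReal_norm, ENNReal.ofReal_pow (norm_nonneg _)]
  have hψ2 : Integrable (fun x => ‖ψ x‖ ^ 2) volume := by
    refine integrable_of_le_decay₃ (C := K' * K') (r := 6) ((cψ.norm).pow 2) (by norm_num)
      fun x => ?_
    rw [norm_pow, norm_norm, sq]
    have hpos : (0 : ℝ) < 1 + ‖x‖ := by positivity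
    calc ‖ψ x‖ * ‖ψ x‖ ≤ (K' * (1 + ‖x‖) ^ (-(3 : ℝ))) * (K' * (1 + ‖x‖) ^ (-(3 : ℝ))) :=
          mul_le_mul (hψ x) (hψ x) (norm_nonneg _) ((norm_nonneg _).trans (hψ x))
      _ = K' * K' * ((1 + ‖x‖) ^ (-(3 : ℝ)) * (1 + ‖x‖) ^ (-(3 : ℝ))) := by ring
      _ = K' * K' * (1 + ‖x‖) ^ (-(6 : ℝ)) := by rw [← Real.rpow_add hpos]; norm_num
  have hψh : Integrable (fun x => ‖ψ x‖ * ‖h x‖) volume := by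
    refine integrable_of_le_decay₃ (C := K' * Ch) (r := 7) (cψ.norm.mul ch.norm) (by norm_num)
      fun x => ?_
    rw [norm_mul, norm_norm, norm_norm]
    have hpos : (0 : ℝ) < 1 + ‖x‖ := by positivity
    calc ‖ψ x‖ * ‖h x‖ ≤ (K' * (1 + ‖x‖) ^ (-(3 : ℝ))) * (Ch * (1 + ‖x‖) ^ (-(4 : ℝ))) :=
          mul_le_mul (hψ x) (hh x) (norm_nonneg _) ((norm_nonneg _).trans (hψ x))
      _ = K' * Ch * ((1 + ‖x‖) ^ (-(3 : ℝ)) * (1 + ‖x‖) ^ (-(4 : ℝ))) := by ring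
      _ = K' * Ch * (1 + ‖x‖) ^ (-(7 : ℝ)) := by rw [← Real.rpow_add hpos]; norm_num
  have hZint : Integrable Z volume := by
    have hb : Integrable (fun x => (‖ψ x‖ ^ 2 + ‖f x‖ ^ 2) / 2 + ‖ψ x‖ * ‖h x‖) volume := by
      exact ((hψ2.add hf2).div_const 2).add hψh
    refine hb.mono' hZ1.continuous.aestronglyMeasurable (Eventually.of_forall fun x => ?_)
    have e0 : ‖Z x‖ ≤ ‖ψ x‖ * ‖gradient q x‖ := norm_cross_le_norm_mul_norm _ _
    have e1 : ‖gradient q x‖ ≤ ‖f x‖ + ‖h x‖ := by rw [hsplit x]; exact norm_sub_le _ _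
    have e2 : ‖ψ x‖ * ‖f x‖ ≤ (‖ψ x‖ ^ 2 + ‖f x‖ ^ 2) / 2 := by
      nlinarith [sq_nonneg (‖ψ x‖ - ‖f x‖)]
    have hψ0 : 0 ≤ ‖ψ x‖ := norm_nonneg _
    calc ‖Z x‖ ≤ ‖ψ x‖ * ‖gradient q x‖ := e0
      _ ≤ ‖ψ x‖ * (‖f x‖ + ‖h x‖) := mul_le_mul_of_nonneg_left e1 hψ0
      _ = ‖ψ x‖ * ‖f x‖ + ‖ψ x‖ * ‖h x‖ := by ring
      _ ≤ (‖ψ x‖ ^ 2 + ‖f x‖ ^ 2) / 2 + ‖ψ x‖ * ‖h x‖ := by linarith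
  have hdivint : Integrable (fun x => VectorCalculus.divergence Z x) volume :=
    hI.congr (Eventually.of_forall fun x => (hdivZ x).symm)
  have h0' := integral_divergence_eq_zero_of_integrable hZ1 hZint hdivint
  rw [← h0']
  exact integral_congr_ae (Eventually.of_forall fun x => (hdivZ x).symm)

end EnstrophyToL3

end Summit.NavierStokesRegularity.NavierStokesRegularity.Theorems
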